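import Summits.ResolutionOfSingularities.ResolutionOfSingularities.Theorems.FrobeniusLadderFInjectiveMacaulayficationDegreeZeroDescentLocal
import Summits.ResolutionOfSingularities.ResolutionOfSingularities.Theorems.FrobeniusLadderFInjectiveMacaulayficationFiLocusOpenOfAffine
import Literature.AlgebraicGeometry.Resolution.BlowupAlgebraPrimesPoints
import Literature.AlgebraicGeometry.Resolution.BlowupsProperProofs
import Literature.AlgebraicGeometry.Resolution.KollarBlowupSequenceFunctors
import Mathlib.AlgebraicGeometry.Noetherian
import HarnessLib

/-!
# FC′ FROM ONE MIXED MODEL — FULL at the non-closed points, Cohen–Macaulay at the closed points over the centre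
# (crux `FInjectiveMacaulayfication` stmt-ResolutionOfSingularities-15315, chain w45a, hole #3γ, FC′ rung r2;
# res-L1-w45a-plan-1 R13.25 (2); text res-L1-w45a-strat-1 `FCRungsSig.lean` v2.4 §A1½, filer res-L1-w45a-stub-2)

[OURS · L1 W4.5a] Support file (`--supports stmt-ResolutionOfSingularities-15315 --as helper`); NOT a statement of any manuscript; no named
fact; no definitions; AI-written (AI review is weaker than expert review).

Companion of `…FCForallExistsOfFullModel` (p534642). There the model `ρ : T → X₁` (a blowing up along `J ∋ η`) had to be FULL at EVERY
point over `supp J`. The witnesses met in dimension ≥ 4 (the K4.5g archetype decided by res-L1-w45a-tri-2, ARCHETYPE.md db5eabb644de14ae: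
the normalisation `X^ν = Bl_{𝓘_{D_red}} X′`, a hypersurface double cover) are FULL at the NON-CLOSED points over the centre and
Cohen–Macaulay at the CLOSED points over the centre, with F-injectivity at those finitely many closed points unchecked — and the FC′ text
never asks for it: its clause (cl) is Cohen–Macaulayness only. This file provides the consumer interface of that shape:

* `isBlowup_stalkTransfer_closed` — two blowing ups along the same ideal sheaf have isomorphic local rings at corresponding points AND the
  correspondence preserves closedness of points (the isomorphism over `X` of `IsBlowup.unique` is a homeomorphism);
* `fcForallExists_body_of_mixedModel` — **`X₁` locally Noetherian, `η` NOT closed, `J ≠ ⊥`, `η ∈ supp J`, `J_η ≠ ⊥`, `ρ : T → X₁` a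
  blowing up along `J` FULL (domain ∧ clause) at the non-closed points of `T` over `supp J` and Cohen–Macaulay at the closed points of `T`
  over `supp J` ⟹ the seven FC′ conjuncts of `GenericFibreReduction.FCForallExists` at `η`**, verbatim, with the witness `J` and `c' :=`
  any generating family of `J_η` (the points of `T` over the non-closed `η` are non-closed because `ρ` is proper, hence a closed map);
* `fcForallExists_body_of_mixedModel_of_isIntegral` — the same on an integral `X₁` (`J_η ≠ ⊥` from `J ≠ ⊥`).

Consumers instantiate by `exact`. [folklore assembly; cite: StacksProject, Tag 0804, Tag 0805; GortzWedhorn2020, Def. 13.90, (13.19)]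
-/

-- single-problem summit: the doubled namespace component is forced
set_option linter.dupNamespace false

noncomputable section

open AlgebraicGeometry CategoryTheory Literature.AlgebraicGeometry.Resolution TopologicalSpace IsLocalRing

namespace Summit.ResolutionOfSingularities.ResolutionOfSingularities.Theorems.FInjectiveMacaulayfication.FCForallExistsOfMixedModel

open Summit.ResolutionOfSingularities.ResolutionOfSingularities.Theorems.FInjectiveMacaulayfication


/-- **Two blowing ups along the same ideal sheaf have the same local rings at corresponding points, and the correspondence
preserves closedness of points** (the isomorphism `IsBlowup.unique` over `X` is a homeomorphism).
[cite: GortzWedhorn2020, (13.19) p. 413] -/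
theorem isBlowup_stalkTransfer_closed {X X' X'' : Scheme.{0}} {J : X.IdealSheafData} {π : X' ⟶ X} {π' : X'' ⟶ X}
    (hπ : IsBlowup π J) (hπ' : IsBlowup π' J) (x' : X') :
    ∃ x'' : X'', π'.base x'' = π.base x' ∧ (IsClosed ({x''} : Set X'') ↔ IsClosed ({x'} : Set X')) ∧
      Nonempty (X'.presheaf.stalk x' ≃+* X''.presheaf.stalk x'') := by
  obtain ⟨e, he, -⟩ := hπ.unique hπ'
  refine ⟨e.hom.base x', ?_, ?_, ⟨(asIso (e.hom.stalkMap x')).commRingCatIsoToRingEquiv.symm⟩⟩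
  · change (e.hom ≫ π').base x' = π.base x'
    rw [he]
  · have h := (Scheme.homeoOfIso e).isClosed_image (s := ({x'} : Set X'))
    rw [Set.image_singleton] at h
    exact h

/-- [OURS] **FC′ FROM ONE MIXED MODEL.** `X₁` locally Noetherian, `η ∈ X₁` NOT closed, `J ≠ ⊥` with `η ∈ supp J` and
`J_η ≠ ⊥`, `ρ : T → X₁` a blowing up along `J` whose stalks over `supp J` are FULL (domain ∧ clause) at the NON-CLOSED points
and Cohen–Macaulay at the CLOSED points ⟹ the seven FC′ conjuncts of `GenericFibreReduction.FCForallExists` at `η`, verbatim,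
with the witness `J` and `c' :=` any generating family of `J_η`. Proof: the charts of `Bl_{(c')} Spec 𝒪_η` over `𝔪_η` are stalks
of `T` at points over `η`, which are non-closed because `ρ` is a closed map (`IsBlowup.isProper`); every blowing up along `J` has
the stalks of `T` at points of the same closedness (`isBlowup_stalkTransfer_closed`). [folklore assembly, OURS · AI-written] -/
theorem fcForallExists_body_of_mixedModel (p : ℕ) [Fact p.Prime] (X₁ : Scheme.{0}) [IsLocallyNoetherian X₁] (η : X₁)
    (hηnc : ¬ IsClosed ({η} : Set X₁))
    (J : X₁.IdealSheafData) (hJ0 : J ≠ ⊥) (hηJ : η ∈ (J.support : Set X₁)) (hJη : stalkIdeal J η ≠ ⊥)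
    (T : Scheme.{0}) (ρ : T ⟶ X₁) (hρ : IsBlowup ρ J)
    (hnc : ∀ t : T, ρ.base t ∈ (J.support : Set X₁) → ¬ IsClosed ({t} : Set T) →
      IsDomain (T.presheaf.stalk t) ∧ ∀ d : ℕ, ringKrullDim (T.presheaf.stalk t) = d → ∀ s : Fin d → T.presheaf.stalk t,
        (Ideal.span (Set.range s)).radical.IsMaximal → RingTheory.Sequence.IsWeaklyRegular (T.presheaf.stalk t) (List.ofFn s) ∧
        ∀ u : T.presheaf.stalk t, (∃ e : ℕ, u ^ p ^ e ∈ Ideal.span ((fun z : T.presheaf.stalk t => z ^ p ^ e) ''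
          (Ideal.span (Set.range s) : Set (T.presheaf.stalk t)))) → u ∈ Ideal.span (Set.range s))
    (hcl : ∀ t : T, ρ.base t ∈ (J.support : Set X₁) → IsClosed ({t} : Set T) →
      ∀ d : ℕ, ringKrullDim (T.presheaf.stalk t) = d → ∀ s : Fin d → T.presheaf.stalk t,
        (Ideal.span (Set.range s)).radical.IsMaximal → RingTheory.Sequence.IsWeaklyRegular (T.presheaf.stalk t) (List.ofFn s)) :
    ∃ (J' : X₁.IdealSheafData) (n' : ℕ) (c' : Fin n' → X₁.presheaf.stalk η), J' ≠ ⊥ ∧ η ∈ (J'.support : Set X₁) ∧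
      Ideal.span (Set.range c') ≠ ⊥ ∧ Ideal.span (Set.range c') ≤ maximalIdeal (X₁.presheaf.stalk η) ∧
      (∀ (j : Fin n') (𝔔 : PrimeSpectrum (blowupAlgebra (Ideal.span (Set.range c')) (c' j))),
        𝔔.asIdeal.comap (algebraMap (X₁.presheaf.stalk η) (blowupAlgebra (Ideal.span (Set.range c')) (c' j))) =
          maximalIdeal (X₁.presheaf.stalk η) →
        IsDomain (Localization.AtPrime 𝔔.asIdeal) ∧ ∀ d : ℕ, ringKrullDim (Localization.AtPrime 𝔔.asIdeal) = d →
          ∀ s : Fin d → Localization.AtPrime 𝔔.asIdeal, (Ideal.span (Set.range s)).radical.IsMaximal →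
            RingTheory.Sequence.IsWeaklyRegular (Localization.AtPrime 𝔔.asIdeal) (List.ofFn s) ∧
            ∀ y : Localization.AtPrime 𝔔.asIdeal, (∃ e : ℕ, y ^ p ^ e ∈ Ideal.span ((fun z : Localization.AtPrime 𝔔.asIdeal => z ^ p ^ e) ''
              (Ideal.span (Set.range s) : Set (Localization.AtPrime 𝔔.asIdeal)))) → y ∈ Ideal.span (Set.range s)) ∧
      stalkIdeal J' η = Ideal.span (Set.range c') ∧
      (∀ (X₂ : Scheme.{0}) (π : X₂ ⟶ X₁), IsBlowup π J' →
        (∀ x : X₂, π.base x ∈ (J'.support : Set X₁) → π.base x ≠ η → ¬ IsClosed ({x} : Set X₂) →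
          IsDomain (X₂.presheaf.stalk x) ∧ ∀ d : ℕ, ringKrullDim (X₂.presheaf.stalk x) = d → ∀ s : Fin d → X₂.presheaf.stalk x,
            (Ideal.span (Set.range s)).radical.IsMaximal → RingTheory.Sequence.IsWeaklyRegular (X₂.presheaf.stalk x) (List.ofFn s) ∧
            ∀ t : X₂.presheaf.stalk x, (∃ e : ℕ, t ^ p ^ e ∈ Ideal.span ((fun z : X₂.presheaf.stalk x => z ^ p ^ e) ''
              (Ideal.span (Set.range s) : Set (X₂.presheaf.stalk x)))) → t ∈ Ideal.span (Set.range s)) ∧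
        (∀ x : X₂, π.base x ∈ (J'.support : Set X₁) → IsClosed ({x} : Set X₂) →
          ∀ d : ℕ, ringKrullDim (X₂.presheaf.stalk x) = d → ∀ s : Fin d → X₂.presheaf.stalk x,
            (Ideal.span (Set.range s)).radical.IsMaximal → RingTheory.Sequence.IsWeaklyRegular (X₂.presheaf.stalk x) (List.ofFn s))) := by
  classical
  haveI : IsProper ρ := hρ.isProper
  -- Cohen–Macaulay at EVERY point of `T` over `supp J`
  have hCM : ∀ t : T, ρ.base t ∈ (J.support : Set X₁) → ∀ d : ℕ, ringKrullDim (T.presheaf.stalk t) = d →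
      ∀ s : Fin d → T.presheaf.stalk t, (Ideal.span (Set.range s)).radical.IsMaximal →
        RingTheory.Sequence.IsWeaklyRegular (T.presheaf.stalk t) (List.ofFn s) := by
    intro t ht d hd s hs
    by_cases hc : IsClosed ({t} : Set T)
    · exact hcl t ht hc d hd s hs
    · exact ((hnc t ht hc).2 d hd s hs).1
  -- the points of `T` over the non-closed point `η` are non-closed (`ρ` is a closed map)
  have hncη : ∀ t : T, ρ.base t = η → ¬ IsClosed ({t} : Set T) := by
    intro t ht hc
    apply hηnc
    have h := ρ.isClosedMap _ hc
    rw [Set.image_singleton] at h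
    have ht' : (ρ : T → X₁) t = η := ht
    rwa [ht'] at h
  -- `c'` := a finite generating family of the stalk ideal `J_η`
  obtain ⟨n', c', hc'⟩ : ∃ (n' : ℕ) (c' : Fin n' → X₁.presheaf.stalk η), Ideal.span (Set.range c') = stalkIdeal J η :=
    Submodule.fg_iff_exists_fin_generating_family.mp (IsNoetherian.noetherian _)
  refine ⟨J, n', c', hJ0, hηJ, ?_, ?_, ?_, hc'.symm, fun X₂ π hπ => ⟨?_, ?_⟩⟩
  · rw [hc']; exact hJη
  · rw [hc']; exact (mem_support_iff_stalkIdeal_le J η).mp hηJ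
  · -- the charts of `Bl_{(c')} Spec 𝒪_η` over `𝔪_η` are stalks of `T` at (non-closed) points over `η`
    intro j 𝔔 h𝔔
    obtain ⟨t, ht, ⟨e⟩⟩ := hρ.exists_point_of_blowupAlgebra_prime η c' hc' j 𝔔 h𝔔
    have ht' : ρ.base t = η := ht
    obtain ⟨hdom, hcl'⟩ := hnc t (by rw [ht']; exact hηJ) (hncη t ht')
    haveI := hdom
    exact ⟨MulEquiv.isDomain _ e.symm.toMulEquiv,
      DegreeZeroDescent.inlineClause_of_ringEquiv p (L := T.presheaf.stalk t) (L' := Localization.AtPrime 𝔔.asIdeal) e hcl'⟩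
  · -- (nc): non-closed points of any blowing up along `J` correspond to non-closed points of `T`
    intro x hx _ hxnc
    obtain ⟨t, ht, hiff, ⟨e⟩⟩ := isBlowup_stalkTransfer_closed hπ hρ x
    obtain ⟨hdom, hcl'⟩ := hnc t (by rw [ht]; exact hx) (fun h => hxnc (hiff.mp h))
    haveI := hdom
    exact ⟨MulEquiv.isDomain _ e.toMulEquiv,
      DegreeZeroDescent.inlineClause_of_ringEquiv p (L := T.presheaf.stalk t) (L' := X₂.presheaf.stalk x) e.symm hcl'⟩
  · -- (cl): Cohen–Macaulay holds at every point of `T` over `supp J`, closed or not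
    intro x hx _ d hd s hs
    obtain ⟨t, ht, -, ⟨e⟩⟩ := isBlowup_stalkTransfer_closed hπ hρ x
    exact FiLocusOpenOfAffine.cmClause_of_ringEquiv e.symm (hCM t (by rw [ht]; exact hx)) d hd s hs

/-- [OURS] the same on an INTEGRAL locally Noetherian `X₁`: `J_η ≠ ⊥` is discharged from `J ≠ ⊥`
(`stalkIdeal_ne_bot_of_ne_bot`). [folklore] -/
theorem fcForallExists_body_of_mixedModel_of_isIntegral (p : ℕ) [Fact p.Prime] (X₁ : Scheme.{0}) [IsLocallyNoetherian X₁]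
    [IsIntegral X₁] (η : X₁) (hηnc : ¬ IsClosed ({η} : Set X₁))
    (J : X₁.IdealSheafData) (hJ0 : J ≠ ⊥) (hηJ : η ∈ (J.support : Set X₁))
    (T : Scheme.{0}) (ρ : T ⟶ X₁) (hρ : IsBlowup ρ J)
    (hnc : ∀ t : T, ρ.base t ∈ (J.support : Set X₁) → ¬ IsClosed ({t} : Set T) →
      IsDomain (T.presheaf.stalk t) ∧ ∀ d : ℕ, ringKrullDim (T.presheaf.stalk t) = d → ∀ s : Fin d → T.presheaf.stalk t,
        (Ideal.span (Set.range s)).radical.IsMaximal → RingTheory.Sequence.IsWeaklyRegular (T.presheaf.stalk t) (List.ofFn s) ∧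
        ∀ u : T.presheaf.stalk t, (∃ e : ℕ, u ^ p ^ e ∈ Ideal.span ((fun z : T.presheaf.stalk t => z ^ p ^ e) ''
          (Ideal.span (Set.range s) : Set (T.presheaf.stalk t)))) → u ∈ Ideal.span (Set.range s))
    (hcl : ∀ t : T, ρ.base t ∈ (J.support : Set X₁) → IsClosed ({t} : Set T) →
      ∀ d : ℕ, ringKrullDim (T.presheaf.stalk t) = d → ∀ s : Fin d → T.presheaf.stalk t,
        (Ideal.span (Set.range s)).radical.IsMaximal → RingTheory.Sequence.IsWeaklyRegular (T.presheaf.stalk t) (List.ofFn s)) :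
    ∃ (J' : X₁.IdealSheafData) (n' : ℕ) (c' : Fin n' → X₁.presheaf.stalk η), J' ≠ ⊥ ∧ η ∈ (J'.support : Set X₁) ∧
      Ideal.span (Set.range c') ≠ ⊥ ∧ Ideal.span (Set.range c') ≤ maximalIdeal (X₁.presheaf.stalk η) ∧
      (∀ (j : Fin n') (𝔔 : PrimeSpectrum (blowupAlgebra (Ideal.span (Set.range c')) (c' j))),
        𝔔.asIdeal.comap (algebraMap (X₁.presheaf.stalk η) (blowupAlgebra (Ideal.span (Set.range c')) (c' j))) =
          maximalIdeal (X₁.presheaf.stalk η) →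
        IsDomain (Localization.AtPrime 𝔔.asIdeal) ∧ ∀ d : ℕ, ringKrullDim (Localization.AtPrime 𝔔.asIdeal) = d →
          ∀ s : Fin d → Localization.AtPrime 𝔔.asIdeal, (Ideal.span (Set.range s)).radical.IsMaximal →
            RingTheory.Sequence.IsWeaklyRegular (Localization.AtPrime 𝔔.asIdeal) (List.ofFn s) ∧
            ∀ y : Localization.AtPrime 𝔔.asIdeal, (∃ e : ℕ, y ^ p ^ e ∈ Ideal.span ((fun z : Localization.AtPrime 𝔔.asIdeal => z ^ p ^ e) ''
              (Ideal.span (Set.range s) : Set (Localization.AtPrime 𝔔.asIdeal)))) → y ∈ Ideal.span (Set.range s)) ∧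
      stalkIdeal J' η = Ideal.span (Set.range c') ∧
      (∀ (X₂ : Scheme.{0}) (π : X₂ ⟶ X₁), IsBlowup π J' →
        (∀ x : X₂, π.base x ∈ (J'.support : Set X₁) → π.base x ≠ η → ¬ IsClosed ({x} : Set X₂) →
          IsDomain (X₂.presheaf.stalk x) ∧ ∀ d : ℕ, ringKrullDim (X₂.presheaf.stalk x) = d → ∀ s : Fin d → X₂.presheaf.stalk x,
            (Ideal.span (Set.range s)).radical.IsMaximal → RingTheory.Sequence.IsWeaklyRegular (X₂.presheaf.stalk x) (List.ofFn s) ∧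
            ∀ t : X₂.presheaf.stalk x, (∃ e : ℕ, t ^ p ^ e ∈ Ideal.span ((fun z : X₂.presheaf.stalk x => z ^ p ^ e) ''
              (Ideal.span (Set.range s) : Set (X₂.presheaf.stalk x)))) → t ∈ Ideal.span (Set.range s)) ∧
        (∀ x : X₂, π.base x ∈ (J'.support : Set X₁) → IsClosed ({x} : Set X₂) →
          ∀ d : ℕ, ringKrullDim (X₂.presheaf.stalk x) = d → ∀ s : Fin d → X₂.presheaf.stalk x,
            (Ideal.span (Set.range s)).radical.IsMaximal → RingTheory.Sequence.IsWeaklyRegular (X₂.presheaf.stalk x) (List.ofFn s))) :=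
  fcForallExists_body_of_mixedModel p X₁ η hηnc J hJ0 hηJ (stalkIdeal_ne_bot_of_ne_bot hJ0 η) T ρ hρ hnc hcl

end Summit.ResolutionOfSingularities.ResolutionOfSingularities.Theorems.FInjectiveMacaulayfication.FCForallExistsOfMixedModel

end
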